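import Literature.AnabelianGeometry.SemiGraphs.Coverticial
import Literature.AnabelianGeometry.SemiGraphs.CoveringOfObject
import Literature.AnabelianGeometry.SemiGraphs.CoveringHomCanonical

/-!
# `𝒢_A → 𝒢` is the finite étale covering attached to `A`; Definition 2.2 (i), existence ([SemiAnbd] p. 23)

Mochizuki, *Semi-graphs of anabelioids*, Publ. RIMS **42** (2006) 221–322, §2 p. 23
[cite: MochizukiSemiAnbd2006, Def. 2.2(i) p.23]: "`B'` itself arises naturally as the `B(−)` of some
semi-graph of anabelioids `𝒢'` equipped with a morphism `𝒢' → 𝒢` … which lies over some proper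
morphism of semi-graphs".  This proof-only file verifies that the semi-graph of anabelioids
`𝒢_A = BObj.coveringGraph A` and the morphism `BObj.coveringHom A : 𝒢_A → 𝒢` constructed in
`CoveringOfObject.lean` satisfy the cell's rendering `Hom.IsFiniteEtaleCoveringOf` (`Coverticial.lean`)
of that description — proper base; vertices/edges over `v`/`e` in bijection with the connected
components of `S_v`/`T_e`; constituents the component anabelioids `(𝒢_v)_P` up to equivalence with
`φ_{v'}^* ≅ (P × −)`; branches matching components through the gluing isomorphisms `ψ_b` — and hence
DISCHARGES the named fact `exists_finiteEtaleCovering` (abc-iut-L3-t1): `exists_finiteEtaleCovering_holds`.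

Bricks: B1 `galoisCategory_over`, B2 `exact_overPost_comp_overPullback` (abc-iut-L3-t6),
B3 `FibredSemiGraph`, B4 `OverStarExact` / `ComponentsOfObjects` / `CoveringOfObject`.
-/

namespace Literature.AnabelianGeometry.SemiGraphs

namespace SemiGraphOfAnabelioids

open CategoryTheory CategoryTheory.Limits CategoryTheory.PreGaloisCategory
open Literature.AnabelianGeometry.Anabelioids

universe v₁ u₁ u

namespace BObj

variable {𝒢 : SemiGraphOfAnabelioids.{v₁, u₁, u}} (A : 𝒢.BObj)

/-- **`𝒢_A → 𝒢` is the finite étale covering attached to `A`** in the sense of [SemiAnbd] p. 23 as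
typed (`Hom.IsFiniteEtaleCoveringOf`): it lies over a proper morphism; the vertices (edges) of `𝔾_A`
over `v` (`e`) are in bijection with the connected components of `S_v` (`T_e`); the constituent at
`(v, P)` is (equivalent to) the component anabelioid `(𝒢_v)_P` with `φ_{(v,P)}^* ≅ (X ↦ P × X)`;
and a branch `(b, Q)` abutting to `(v, P)` exhibits `Q ⊆ ψ_b(b^* P)`.
[cite: MochizukiSemiAnbd2006, Def. 2.2(i) p.23] -/
theorem coveringHom_isFiniteEtaleCoveringOf : A.coveringHom.IsFiniteEtaleCoveringOf A := by
  refine ⟨A.fibreData.isProper_proj, fun vc => A.vComp vc, fun ec => A.eComp ec, ?_, ?_, ?_, ?_, ?_⟩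
  · -- vertices of `𝔾_A` ↔ components of the `S_v`
    constructor
    · rintro ⟨v, c⟩ ⟨v', c'⟩ hvc
      change (⟨v, A.vComp ⟨v, c⟩⟩ : Σ w, π₀Obj (A.S w)) = ⟨v', A.vComp ⟨v', c'⟩⟩ at hvc
      obtain ⟨rfl, h2⟩ := Sigma.mk.inj_iff.mp hvc
      obtain rfl : c = c' := (equivShrink _).symm.injective (eq_of_heq h2)
      rfl
    · rintro ⟨v, P⟩
      exact ⟨⟨v, equivShrink _ P⟩, Sigma.ext rfl (heq_of_eq (Equiv.symm_apply_apply _ _))⟩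
  · -- edges of `𝔾_A` ↔ components of the `T_e`
    constructor
    · rintro ⟨e, c⟩ ⟨e', c'⟩ hec
      change (⟨e, A.eComp ⟨e, c⟩⟩ : Σ f, π₀Obj (A.T f)) = ⟨e', A.eComp ⟨e', c'⟩⟩ at hec
      obtain ⟨rfl, h2⟩ := Sigma.mk.inj_iff.mp hec
      obtain rfl : c = c' := (equivShrink _).symm.injective (eq_of_heq h2)
      rfl
    · rintro ⟨e, Q⟩
      exact ⟨⟨e, equivShrink _ Q⟩, Sigma.ext rfl (heq_of_eq (Equiv.symm_apply_apply _ _))⟩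
  · -- the vertex constituents are the component anabelioids, `φ^* = (P × −)`
    intro vc
    exact ⟨(Shrink.equivalence (Over ((A.vComp vc).1 : 𝒢.V (A.fibreData.proj.vertexMap vc)))).functor,
      inferInstance, ⟨Iso.refl _⟩⟩
  · -- the edge constituents
    intro ec
    exact ⟨(Shrink.equivalence (Over ((A.eComp ec).1 : 𝒢.E (A.fibreData.proj.edgeMap ec)))).functor,
      inferInstance, ⟨Iso.refl _⟩⟩
  · -- branches match components through the gluing isomorphisms
    intro bc vc h
    refine ⟨A.inclOfLE (abuts_fst h) (A.vComp vc).1 (A.brComp bc).1 (brComp_le_branchImage h), ?_⟩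
    change A.inclOfLE (abuts_fst h) (A.vComp vc).1 (A.brComp bc).1 (brComp_le_branchImage h) ≫
      ((𝒢.pull (A.fibreData.proj.branchMap bc) (A.fibreData.proj.vertexMap vc) (abuts_fst h)).pullback.map
          (A.vComp vc).1.arrow ≫
        (A.ψ (A.fibreData.proj.branchMap bc) (A.fibreData.proj.vertexMap vc) (abuts_fst h)).hom) ≫ 𝟙 _ =
      (A.brComp bc).1.arrow
    rw [Category.comp_id]
    exact A.inclOfLE_comp _ _ _ _

/-- `𝒢_A → 𝒢` is a finite étale covering ([SemiAnbd] Def. 2.2 (i)).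
[cite: MochizukiSemiAnbd2006, Def. 2.2(i) p.24] -/
theorem coveringHom_isFiniteEtaleCovering : A.coveringHom.IsFiniteEtaleCovering :=
  ⟨A, A.coveringHom_isFiniteEtaleCoveringOf⟩

/-- The same for the variant `coveringHomCan` with canonical 2-cells (`CoveringHomCanonical.lean`):
the statement does not involve the 2-cells. [cite: MochizukiSemiAnbd2006, Def. 2.2(i) p.23] -/
theorem coveringHomCan_isFiniteEtaleCoveringOf : A.coveringHomCan.IsFiniteEtaleCoveringOf A := by
  refine ⟨A.fibreData.isProper_proj, fun vc => A.vComp vc, fun ec => A.eComp ec, ?_, ?_, ?_, ?_, ?_⟩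
  · -- vertices of `𝔾_A` ↔ components of the `S_v`
    constructor
    · rintro ⟨v, c⟩ ⟨v', c'⟩ hvc
      change (⟨v, A.vComp ⟨v, c⟩⟩ : Σ w, π₀Obj (A.S w)) = ⟨v', A.vComp ⟨v', c'⟩⟩ at hvc
      obtain ⟨rfl, h2⟩ := Sigma.mk.inj_iff.mp hvc
      obtain rfl : c = c' := (equivShrink _).symm.injective (eq_of_heq h2)
      rfl
    · rintro ⟨v, P⟩
      exact ⟨⟨v, equivShrink _ P⟩, Sigma.ext rfl (heq_of_eq (Equiv.symm_apply_apply _ _))⟩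
  · -- edges of `𝔾_A` ↔ components of the `T_e`
    constructor
    · rintro ⟨e, c⟩ ⟨e', c'⟩ hec
      change (⟨e, A.eComp ⟨e, c⟩⟩ : Σ f, π₀Obj (A.T f)) = ⟨e', A.eComp ⟨e', c'⟩⟩ at hec
      obtain ⟨rfl, h2⟩ := Sigma.mk.inj_iff.mp hec
      obtain rfl : c = c' := (equivShrink _).symm.injective (eq_of_heq h2)
      rfl
    · rintro ⟨e, Q⟩
      exact ⟨⟨e, equivShrink _ Q⟩, Sigma.ext rfl (heq_of_eq (Equiv.symm_apply_apply _ _))⟩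
  · -- the vertex constituents are the component anabelioids, `φ^* = (P × −)`
    intro vc
    exact ⟨(Shrink.equivalence (Over ((A.vComp vc).1 : 𝒢.V (A.fibreData.proj.vertexMap vc)))).functor,
      inferInstance, ⟨Iso.refl _⟩⟩
  · -- the edge constituents
    intro ec
    exact ⟨(Shrink.equivalence (Over ((A.eComp ec).1 : 𝒢.E (A.fibreData.proj.edgeMap ec)))).functor,
      inferInstance, ⟨Iso.refl _⟩⟩
  · -- branches match components through the gluing isomorphisms
    intro bc vc h
    refine ⟨A.inclOfLE (abuts_fst h) (A.vComp vc).1 (A.brComp bc).1 (brComp_le_branchImage h), ?_⟩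
    change A.inclOfLE (abuts_fst h) (A.vComp vc).1 (A.brComp bc).1 (brComp_le_branchImage h) ≫
      ((𝒢.pull (A.fibreData.proj.branchMap bc) (A.fibreData.proj.vertexMap vc) (abuts_fst h)).pullback.map
          (A.vComp vc).1.arrow ≫
        (A.ψ (A.fibreData.proj.branchMap bc) (A.fibreData.proj.vertexMap vc) (abuts_fst h)).hom) ≫ 𝟙 _ =
      (A.brComp bc).1.arrow
    rw [Category.comp_id]
    exact A.inclOfLE_comp _ _ _ _

end BObj

/-- NAMED FACT `exists_finiteEtaleCovering` ([SemiAnbd] p. 23, Definition 2.2 (i), existence half),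
PROVED: for every semi-graph of anabelioids `𝒢` and every object `G' = A` of `B(𝒢)`, the semi-graph
of anabelioids `𝒢_A` of components, with its morphism `𝒢_A → 𝒢`, is the finite étale covering
attached to `A`.  (The connectedness and vertex hypotheses of the fact are not needed for the
construction.) [cite: MochizukiSemiAnbd2006, Def. 2.2(i) p.23] -/
theorem exists_finiteEtaleCovering_holds : exists_finiteEtaleCovering.{v₁, u₁, u} :=
  fun _ _ _ A => ⟨A.coveringGraph, A.coveringHom, A.coveringHom_isFiniteEtaleCoveringOf⟩

end SemiGraphOfAnabelioids

end Literature.AnabelianGeometry.SemiGraphs
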